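import Summits.QuantumFields.BalabanUV.T4Continuum.Support.NE9MarginalProjection
import Summits.QuantumFields.BalabanUV.T4Continuum.Support.NE9ComplexEncoding
import Summits.QuantumFields.BalabanUV.T4Continuum.Support.SubstrateProbesOfRecord

/-!
# NE9ChartReadOut — the read-out binders RO of NE9's END (`ReadAdditive ∕ ReadZero ∕ ReadSize` of `NE9MarginalProjection` §2)
# DISCHARGED for FINITE PROBE RECIPES IN THE CHART ENCODING: carriers = the doubled carriers `NE9ComplexEncoding.doubleCarriers C₀`
# (re ∕ im copies of every localization domain), background slot = the complex chart variable `A : E`; the recipe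
# `r k H = Σ_{p ∈ idx k} wt_p · Re ∂²[A ↦ H A (X_p, re) + i·H A (X_p, im)](a_p, b_p)` (a finite truncation of the printed TYPE of
# [I] (1.20)–(1.22) read through (4.3)); the Cauchy step of `T4BetaReadOutLipschitz` §3 (node U2's (R) BY SHAPE) gives
# `ReadSize` with `cr = 8K∕α²` on every admissible class of probe-analytic slices (cell `pub-balaban`, T4-DAG §2 node U3 ∕ §6 NE9;
# BINDER row NE9 OWNER lineage `b2b-balaban-t4-ne9-p1`, generation 37; record `t4/T4-EST-NE9-P1.md` §43.8 (b); WALL-NE9-P1 §2 row «MP RO AW»)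

HONEST FRAMING (T4-DAG PAGE 1).  Rung (B)+1 of the FINITE-VOLUME T⁴ programme — NOT infinite volume, NOT a mass gap, NOT the
Clay problem.  NE9 (`T4OutputRate.NE9` ∧ `FadingMemory`) is a cell NEW ESTIMATE, NOT PRINTED in [I] = [Balaban1987RG1] (CMP **109**),
[II] = [Balaban1988RG2Cluster] (CMP **116**), and NOT PROVED for Bałaban's E^{(j)} («NE9 ⇐ the named binders»; spine PROVED 0∕9).
HONEST DEPENDENCY (cell line, verbatim): continuum YM on T⁴ ⇐ BetaPertH ∧ nine spine estimates (0/9 proved); BetaPertH ⇐ (D1) ∧ (D4)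
∧ CAP+tail; G-an2-4 gates asym, D1 and NE2/3/4.  `FlowStep.BetaPertH`, (B), (B^μ) do not occur.  Elementary bookkeeping + two Cauchy
estimates of `B12Decay510`∕`T4BetaReadOutLipschitz` re-run in the chart encoding; the located constant `K` (locality sum) and the chart
radius `α` are DISPLAYED letters, NOT PRINTED, NOT discharged; nothing of Bałaban's asserted (ABSOLUTE RULE); 0 sorry.

WHY.  NE9's END of record (`NE9EndOfRecordPrint.termSize_ne9_and_fadingMemory_print`, p235043) feeds its history channel the
marginal-free projection `margProj (r U) (A U)` of the old terms (`NE9MarginalProjection` §2) and DISPLAYS, per real background `U`, the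
read-out binders `hrA : ReadAdditive (Adm U) (r U)`, `hr0 : ReadZero (r U)`, `hrs : ReadSize (Adm U) (r U) κ cr` for an ABSTRACT read-out
`r U : ℕ → (E → (doubleCarriers C₀).Dom → ℝ) → ℝ` on slices of the chart variable.  `T4BetaReadOutLipschitz.Probes` (node U2∕U3's real
slices) stores Re∕Im at two BACKGROUND labels of ONE domain; NE9's END stores them at the two COPIES `(X, true) ∕ (X, false)` of the
domain at ONE chart point — so the probe structure is re-typed here (`ChartProbes`, §1) and §3 of `T4BetaReadOutLipschitz` re-run for it.
WHAT IS PROVED.  §1 `ChartProbes`, `cplx`, `recipe`, `Analytic α` (the locality letter `K` stays a displayed hypothesis, no `def … : Prop`); §2 `recipe_zero`, `recipe_restrictScale`,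
`recipe_sub` (linearity on probe-analytic slices, `mixedDeriv_sub`), class lemmas; §3 `norm_cplx_sub_le` (slice-closeness ⇒ `2M·e^{−κd}`
closeness of the rebuilt chart functions), **`readBoundedOn_recipe`** (`ReadBoundedOn (Analytic α) recipe κ (8K∕α²)`, node U2's (R) shape),
**`readSize_shiftRead_recipe`**, **`readAdditive_shiftRead_recipe`**, **`readZero_shiftRead_recipe`** — the END's `hrs ∕ hrA ∕ hr0` for
`r := shiftRead recipe` on ANY class `Adm ⊆ Analytic α`; §4 the SINGLE-CUBE chart probes OF RECORD `cubeChartProbes R dirA dirB wt`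
(`idx k` = the substrate's `SubstrateProbesOfRecord.cubeIdx R k`, `dom` = identity; single cubes have `d = 0`, so the locality letter is the
plain sum `Σ_{□} |wt|‖a‖‖b‖`), every step non-empty; §5 the AW companion `dirSize_of_cubeSupported` (a marginal direction supported on
single cubes and bounded by `a` there has `DirSize A κ a` at every `κ` — the bound itself stays the T-letter AW).  Consumer:
`NE9EndOfRecordReadOut` (the END with RO discharged).

References (TYPES ∕ loci only): [Balaban1987RG1] T. Bałaban, CMP **109** (1987) 249–301, (1.18) p. 263, (1.20)–(1.22) p. 264, (4.3)–(4.5)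
pp. 281–282; [Balaban1988RG2Cluster] T. Bałaban, CMP **116** (1988) 1–22, (1.33) p. 9.  Summits-side NEW work (LEAN PLACEMENT RULE);
imports `NE9MarginalProjection` (lineage g22), `NE9ComplexEncoding` and the substrate's `SubstrateProbesOfRecord` (S-PROBE, `cubeIdx`) BY NAME;
modifies nothing.  Value = three displayed binders
of the row's END replaced by a recipe of printed type + two letters, NOT summit progress.
-/

noncomputable section

namespace Summit.QuantumFields.BalabanUV.T4Continuum.NE9ChartReadOut

open scoped BigOperators
open Metric Set
open Literature.MathematicalPhysics.QuantumFieldTheory.Balaban1983to89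
open Literature.MathematicalPhysics.QuantumFieldTheory.Balaban1983to89.T4OutputRate
open Literature.MathematicalPhysics.QuantumFieldTheory.Balaban1983to89.T4BetaReadOut
open Literature.MathematicalPhysics.QuantumFieldTheory.Balaban1983to89.T4BetaReadOutLipschitz
open Literature.MathematicalPhysics.QuantumFieldTheory.Balaban1983to89.T4HistoryLipschitzRecursion
open Literature.MathematicalPhysics.QuantumFieldTheory.Balaban1983to89.B12Decay510
open Summit.QuantumFields.BalabanUV.T4Continuum.NE9ComplexEncoding (doubleCarriers)
open Summit.QuantumFields.BalabanUV.T4Continuum.NE9MarginalProjection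

/-! ## §1 Finite probe recipes in the chart encoding -/

/-- DATA: **A FINITE PROBE RECIPE IN THE CHART ENCODING** — at step `k`, finitely many probes `p ∈ idx k`, each reading ONE localization
domain `dom k p` of scale `k + 1` along a pair of chart directions `dirA ∕ dirB : E` with a real weight `wt` (the printed TYPE of
[I] (1.20)–(1.22) read through (4.3): second variational derivative along `h_X(x), h_X(y)`, second-moment weights; a finite truncation at
finite volume).  The slice it reads is `H : E → (doubleCarriers C₀).Dom → ℝ` — Re at `(X, true)`, Im at `(X, false)` (NE9's encoding,
`NE9ComplexEncoding.reIm`).  Nothing of [I] is asserted. [cite: Balaban1987RG1, (1.20)-(1.22) p.264 and (4.3)-(4.4) p.281] -/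
structure ChartProbes (C₀ : Carriers) (E : Type) [NormedAddCommGroup E] [NormedSpace ℂ E] (ι : Type) where
  /-- the probes read at step k -/
  idx : ℕ → Finset ι
  /-- the localization domain read by probe p -/
  dom : ℕ → ι → C₀.Dom
  /-- it lies on the scale-(k+1) slice -/
  scale_dom : ∀ k p, p ∈ idx k → C₀.scale (dom k p) = k + 1
  /-- first chart direction of the mixed derivative -/
  dirA : ℕ → ι → E
  /-- second chart direction of the mixed derivative -/
  dirB : ℕ → ι → E
  /-- real weight of the probe -/
  wt : ℕ → ι → ℝ

variable {C₀ : Carriers} {E : Type} [NormedAddCommGroup E] [NormedSpace ℂ E] {ι : Type}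

/-- DATA: the complex term REBUILT from the doubled real encoding at the domain `X`: `A ↦ H A (X, re) + i·H A (X, im)` (inverse of
`NE9ComplexEncoding.reIm` at fixed couplings). [cite: Balaban1987RG1, (4.4) p.281] -/
def cplx (H : E → (doubleCarriers C₀).Dom → ℝ) (X : C₀.Dom) : E → ℂ :=
  fun A => ((H A (X, true) : ℝ) : ℂ) + ((H A (X, false) : ℝ) : ℂ) * Complex.I

namespace ChartProbes

variable (Pr : ChartProbes C₀ E ι)

/-- THE RECIPE of the chart probe structure: `r k H = Σ_{p ∈ idx k} wt_p · Re ∂²[cplx H X_p](a_p, b_p)` — a finite truncation of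
(1.20)–(1.22) of printed TYPE, as a `T4BetaReadOut.ReadOut` on the doubled carriers with the chart variable in the background slot.
[cite: Balaban1987RG1, (1.20)-(1.22) p.264] -/
def recipe : ReadOut (doubleCarriers C₀) E :=
  fun k H => ∑ p ∈ Pr.idx k, Pr.wt k p * (mixedDeriv (cplx H (Pr.dom k p)) (Pr.dirA k p) (Pr.dirB k p)).re

/-- THE PROBE-ANALYTIC CLASS: slices whose rebuilt chart functions are analytic on the chart ball `‖A‖ < α` at every probe read (the
printed-type analyticity (1.17)∕(4.4) of the instancer's terms; a HYPOTHESIS on the slice, never a fact).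
[cite: Balaban1987RG1, (1.17) p.263 and (4.4) p.281] -/
def Analytic (α : ℝ) : Set (E → (doubleCarriers C₀).Dom → ℝ) :=
  {H | ∀ k p, p ∈ Pr.idx k → AnalyticOnNhd ℂ (cplx H (Pr.dom k p)) (ball 0 α)}

end ChartProbes

/-! ## §2 Linearity of the recipe on probe-analytic slices; the class is stable under scale restriction -/

omit [NormedAddCommGroup E] [NormedSpace ℂ E] in
/-- The rebuilt chart function of the zero slice is zero. [folklore] -/
@[simp] theorem cplx_zero (X : C₀.Dom) : cplx (0 : E → (doubleCarriers C₀).Dom → ℝ) X = 0 := by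
  funext A
  change (((0 : ℝ)) : ℂ) + (((0 : ℝ)) : ℂ) * Complex.I = 0
  simp

omit [NormedAddCommGroup E] [NormedSpace ℂ E] in
/-- The rebuilt chart function of a difference is the difference. [folklore] -/
theorem cplx_sub (H₁ H₂ : E → (doubleCarriers C₀).Dom → ℝ) (X : C₀.Dom) : cplx (H₁ - H₂) X = cplx H₁ X - cplx H₂ X := by
  funext A
  simp only [cplx, Pi.sub_apply, Complex.ofReal_sub]
  ring

omit [NormedAddCommGroup E] [NormedSpace ℂ E] in
/-- On a domain of the creation step `j` the restriction to step `j` rebuilds the same chart function. [folklore] -/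
theorem cplx_restrictScale_of_eq {j : ℕ} (H : E → (doubleCarriers C₀).Dom → ℝ) {X : C₀.Dom} (h : C₀.scale X = j) :
    cplx (restrictScale j H) X = cplx H X := by
  funext A
  have ht : (doubleCarriers C₀).scale (X, true) = j := h
  have hf : (doubleCarriers C₀).scale (X, false) = j := h
  simp only [cplx, restrictScale_of_eq H ht, restrictScale_of_eq H hf]

omit [NormedAddCommGroup E] [NormedSpace ℂ E] in
/-- Off the creation step the restriction rebuilds the zero chart function. [folklore] -/
theorem cplx_restrictScale_of_ne {j : ℕ} (H : E → (doubleCarriers C₀).Dom → ℝ) {X : C₀.Dom} (h : C₀.scale X ≠ j) :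
    cplx (restrictScale j H) X = 0 := by
  funext A
  have ht : (doubleCarriers C₀).scale (X, true) ≠ j := h
  have hf : (doubleCarriers C₀).scale (X, false) ≠ j := h
  simp [cplx, restrictScale_of_ne H ht, restrictScale_of_ne H hf]

/-- The (4.3) mixed derivative of the zero function vanishes. [folklore] -/
theorem mixedDeriv_zero (a b : E) : mixedDeriv (0 : E → ℂ) a b = 0 := by
  unfold mixedDeriv
  have h : (fun τ : ℂ => (fderiv ℂ (0 : E → ℂ) (τ • b)) a) = fun _ => 0 := by
    funext τ
    rw [show (0 : E → ℂ) = fun _ => (0 : ℂ) from rfl]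
    simp
  rw [h, deriv_const]

variable (Pr : ChartProbes C₀ E ι)

/-- **The recipe of the zero slice vanishes** (the END's `ReadZero`). [folklore] -/
theorem recipe_zero (k : ℕ) : Pr.recipe k 0 = 0 := by
  unfold ChartProbes.recipe
  refine Finset.sum_eq_zero fun p _ => ?_
  rw [cplx_zero, mixedDeriv_zero, Complex.zero_re, mul_zero]

/-- **The step-k recipe reads only the scale-(k+1) slice**: it does not see the restriction. [folklore] -/
theorem recipe_restrictScale (k : ℕ) (H : E → (doubleCarriers C₀).Dom → ℝ) :
    Pr.recipe k (restrictScale (k + 1) H) = Pr.recipe k H := by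
  unfold ChartProbes.recipe
  exact Finset.sum_congr rfl fun p hp => by rw [cplx_restrictScale_of_eq H (Pr.scale_dom k p hp)]

/-- **Linearity of the recipe on probe-analytic slices** ((1.20) is linear in the term family; `mixedDeriv_sub` needs the analyticity
of both rebuilt chart functions on the ball). [cite: Balaban1987RG1, (1.20) p.264 and (4.3) p.281] -/
theorem recipe_sub {α : ℝ} (hα : 0 < α) {H₁ H₂ : E → (doubleCarriers C₀).Dom → ℝ} (h₁ : H₁ ∈ Pr.Analytic α)
    (h₂ : H₂ ∈ Pr.Analytic α) (k : ℕ) : Pr.recipe k (H₁ - H₂) = Pr.recipe k H₁ - Pr.recipe k H₂ := by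
  unfold ChartProbes.recipe
  rw [← Finset.sum_sub_distrib]
  refine Finset.sum_congr rfl fun p hp => ?_
  rw [cplx_sub, mixedDeriv_sub hα (h₁ k p hp) (h₂ k p hp), Complex.sub_re, mul_sub]

/-- The zero slice is probe-analytic. [folklore] -/
theorem zero_mem_analytic (α : ℝ) : (0 : E → (doubleCarriers C₀).Dom → ℝ) ∈ Pr.Analytic α := by
  intro k p _
  rw [cplx_zero]
  exact analyticOnNhd_const

/-- The probe-analytic class is stable under restriction to a creation step. [folklore] -/
theorem restrictScale_mem_analytic {α : ℝ} {H : E → (doubleCarriers C₀).Dom → ℝ} (hH : H ∈ Pr.Analytic α) (j : ℕ) :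
    restrictScale j H ∈ Pr.Analytic α := by
  intro k p hp
  by_cases h : C₀.scale (Pr.dom k p) = j
  · rw [cplx_restrictScale_of_eq H h]
    exact hH k p hp
  · rw [cplx_restrictScale_of_ne H h]
    exact analyticOnNhd_const

/-- The difference of two probe-analytic slices is probe-analytic. [folklore] -/
theorem sub_mem_analytic {α : ℝ} {H₁ H₂ : E → (doubleCarriers C₀).Dom → ℝ} (h₁ : H₁ ∈ Pr.Analytic α) (h₂ : H₂ ∈ Pr.Analytic α) :
    H₁ - H₂ ∈ Pr.Analytic α := by
  intro k p hp
  rw [cplx_sub]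
  exact (h₁ k p hp).sub (h₂ k p hp)

/-- The locality letter — the DISPLAYED hypothesis `Σ_{p ∈ idx k} |wt_p|‖a_p‖‖b_p‖e^{−κd(X_p)} ≤ K` uniformly in `k` (located, NOT
PRINTED, NOT discharged here; no `def … : Prop` is minted for it) — is non-negative. [folklore] -/
theorem localitySum_nonneg {κ K : ℝ} (hK : ∀ k, ∑ p ∈ Pr.idx k, |Pr.wt k p| * ‖Pr.dirA k p‖ * ‖Pr.dirB k p‖ * Real.exp (-(κ * C₀.d (Pr.dom k p))) ≤ K) : 0 ≤ K :=
  (Finset.sum_nonneg fun p _ => by positivity).trans (hK 0)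

/-! ## §3 The Cauchy step in the chart encoding: `ReadBoundedOn`, and the END's `ReadSize ∕ ReadAdditive ∕ ReadZero` -/

omit [NormedAddCommGroup E] [NormedSpace ℂ E] in
/-- Slice-closeness on the scale-(k+1) slice of the doubled carriers makes the rebuilt chart functions `2M·e^{−κd(X)}`-close at every
chart point (re and im parts each `M·e^{−κd}`-close). [cite: Balaban1987RG1, (1.18) p.263] -/
theorem norm_cplx_sub_le {κ : ℝ} {k : ℕ} {F G : E → (doubleCarriers C₀).Dom → ℝ} {M : ℝ} (hFG : SliceClose κ k F G M) {X : C₀.Dom}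
    (hX : C₀.scale X = k + 1) (v : E) : ‖cplx F X v - cplx G X v‖ ≤ 2 * M * Real.exp (-(κ * C₀.d X)) := by
  have ht := hFG v (X, true) hX
  have hf := hFG v (X, false) hX
  have hre : ‖(((F v (X, true) - G v (X, true) : ℝ)) : ℂ)‖ ≤ M * Real.exp (-(κ * C₀.d X)) := by
    rw [Complex.norm_real, Real.norm_eq_abs]; exact ht
  have him : ‖(((F v (X, false) - G v (X, false) : ℝ)) : ℂ) * Complex.I‖ ≤ M * Real.exp (-(κ * C₀.d X)) := by
    rw [norm_mul, Complex.norm_I, mul_one, Complex.norm_real, Real.norm_eq_abs]; exact hf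
  calc ‖cplx F X v - cplx G X v‖
      = ‖(((F v (X, true) - G v (X, true) : ℝ)) : ℂ) + (((F v (X, false) - G v (X, false) : ℝ)) : ℂ) * Complex.I‖ := by
        simp only [cplx, Complex.ofReal_sub]; ring_nf
    _ ≤ ‖(((F v (X, true) - G v (X, true) : ℝ)) : ℂ)‖ + ‖(((F v (X, false) - G v (X, false) : ℝ)) : ℂ) * Complex.I‖ := norm_add_le _ _
    _ ≤ M * Real.exp (-(κ * C₀.d X)) + M * Real.exp (-(κ * C₀.d X)) := add_le_add hre him
    _ = 2 * M * Real.exp (-(κ * C₀.d X)) := by ring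

/-- **THE READ-OUT BOUND ON THE PROBE-ANALYTIC CLASS, CHART ENCODING** (node U2's (R) shape `ReadBoundedOn`, constant `8K∕α²`):
two probe-analytic slices `M·e^{−κd}`-close on the scale-(k+1) slice have `8K∕α²·M`-close step-k recipes — `sum_re_mixedDeriv_sub_le`
(two one-variable Cauchy estimates per probe, (4.3)–(4.5)) + the locality sum.  Every step reads at least one probe (else `M ≥ 0` is
not forced). [cite: Balaban1987RG1, (1.18) p.263, (1.20)-(1.22) p.264 and (4.3)-(4.5) pp.281-282] -/
theorem readBoundedOn_recipe {α κ K : ℝ} (hα : 0 < α) (hK : ∀ k, ∑ p ∈ Pr.idx k, |Pr.wt k p| * ‖Pr.dirA k p‖ * ‖Pr.dirB k p‖ * Real.exp (-(κ * C₀.d (Pr.dom k p))) ≤ K) (hne : ∀ k, (Pr.idx k).Nonempty) :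
    ReadBoundedOn (Pr.Analytic α) Pr.recipe κ (8 * K / α ^ 2) := by
  intro k F G M hF hG hFG
  obtain ⟨p₀, hp₀⟩ := hne k
  have hM : 0 ≤ M := by
    have h := hFG (0 : E) (Pr.dom k p₀, true) (Pr.scale_dom k p₀ hp₀)
    exact nonneg_of_mul_nonneg_left ((abs_nonneg _).trans h) (Real.exp_pos _)
  have hc : ∀ p ∈ Pr.idx k, ∀ v ∈ ball (0 : E) α,
      ‖cplx F (Pr.dom k p) v - cplx G (Pr.dom k p) v‖ ≤ (2 * M) * Real.exp (-(κ * C₀.d (Pr.dom k p))) :=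
    fun p hp v _ => norm_cplx_sub_le hFG (Pr.scale_dom k p hp) v
  have key := sum_re_mixedDeriv_sub_le (Pr.idx k) (a := Pr.dirA k) (b := Pr.dirB k) (wt := Pr.wt k) hα
    (fun p hp => hF k p hp) (fun p hp => hG k p hp) hc
  calc |Pr.recipe k F - Pr.recipe k G|
      ≤ 4 * (2 * M) / α ^ 2 * ∑ p ∈ Pr.idx k,
          |Pr.wt k p| * ‖Pr.dirA k p‖ * ‖Pr.dirB k p‖ * Real.exp (-(κ * C₀.d (Pr.dom k p))) := key
    _ ≤ 4 * (2 * M) / α ^ 2 * K := mul_le_mul_of_nonneg_left (hK k) (by positivity)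
    _ = 8 * K / α ^ 2 * M := by ring

/-- **THE END's `hr0`**: the shifted recipe of the zero family vanishes. [folklore] -/
theorem readZero_shiftRead_recipe : ReadZero (shiftRead Pr.recipe) :=
  readZero_shiftRead (recipe_zero Pr)

/-- **THE END's `hrA`**: on any class of probe-analytic slices the shifted recipe is additive ((1.20)–(1.22) linear in the family).
[cite: Balaban1987RG1, (1.20)-(1.22) p.264] -/
theorem readAdditive_shiftRead_recipe {α : ℝ} (hα : 0 < α) {Adm : Set (E → (doubleCarriers C₀).Dom → ℝ)}
    (hAdm : Adm ⊆ Pr.Analytic α) : ReadAdditive Adm (shiftRead Pr.recipe) := by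
  refine readAdditive_shiftRead fun k H₁ h₁ H₂ h₂ => ?_
  rw [recipe_restrictScale, recipe_restrictScale, recipe_restrictScale, recipe_sub Pr hα (hAdm h₁) (hAdm h₂)]

/-- **THE END's `hrs`**: on any class of probe-analytic slices the shifted recipe has the per-step size bound `ReadSize Adm r κ (8K∕α²)`
— a scale-`j` family of size `N·e^{−κd}` is `N·e^{−κd}`-close to the zero family, whose recipe vanishes; nothing is read at `j = 0`.
[cite: Balaban1987RG1, (1.18) p.263, (1.20)-(1.22) p.264 and (4.3)-(4.5) pp.281-282] -/
theorem readSize_shiftRead_recipe {α κ K : ℝ} (hα : 0 < α) (hK : ∀ k, ∑ p ∈ Pr.idx k, |Pr.wt k p| * ‖Pr.dirA k p‖ * ‖Pr.dirB k p‖ * Real.exp (-(κ * C₀.d (Pr.dom k p))) ≤ K) {Adm : Set (E → (doubleCarriers C₀).Dom → ℝ)}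
    (hAdm : Adm ⊆ Pr.Analytic α) : ReadSize Adm (shiftRead Pr.recipe) κ (8 * K / α ^ 2) := by
  have hK0 : 0 ≤ K := localitySum_nonneg Pr hK
  intro j H hH N hN hbound
  by_cases hj : j = 0
  · simp only [shiftRead, hj, if_true, abs_zero]
    positivity
  · obtain ⟨k, rfl⟩ := Nat.exists_eq_succ_of_ne_zero hj
    simp only [shiftRead, Nat.succ_ne_zero, if_false, Nat.succ_sub_one]
    rw [recipe_restrictScale]
    have hHan : H ∈ Pr.Analytic α := hAdm hH
    have hc : ∀ p ∈ Pr.idx k, ∀ v ∈ ball (0 : E) α,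
        ‖cplx H (Pr.dom k p) v - cplx (0 : E → (doubleCarriers C₀).Dom → ℝ) (Pr.dom k p) v‖ ≤
          (2 * N) * Real.exp (-(κ * C₀.d (Pr.dom k p))) := by
      intro p hp v _
      refine norm_cplx_sub_le (κ := κ) (k := k) (M := N) (fun A X hX => ?_) (Pr.scale_dom k p hp) v
      rw [Pi.zero_apply, Pi.zero_apply, sub_zero, mul_comm]
      exact hbound A X hX
    have key := sum_re_mixedDeriv_sub_le (Pr.idx k) (a := Pr.dirA k) (b := Pr.dirB k) (wt := Pr.wt k) hα
      (fun p hp => hHan k p hp) (fun p hp => zero_mem_analytic Pr α k p hp) hc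
    have h0 : Pr.recipe k 0 = 0 := recipe_zero Pr k
    unfold ChartProbes.recipe at h0 ⊢
    rw [← sub_zero (∑ p ∈ Pr.idx k, Pr.wt k p * (mixedDeriv (cplx H (Pr.dom k p)) (Pr.dirA k p) (Pr.dirB k p)).re), ← h0]
    calc |∑ p ∈ Pr.idx k, Pr.wt k p * (mixedDeriv (cplx H (Pr.dom k p)) (Pr.dirA k p) (Pr.dirB k p)).re -
            ∑ p ∈ Pr.idx k, Pr.wt k p * (mixedDeriv (cplx 0 (Pr.dom k p)) (Pr.dirA k p) (Pr.dirB k p)).re|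
        ≤ 4 * (2 * N) / α ^ 2 * ∑ p ∈ Pr.idx k,
            |Pr.wt k p| * ‖Pr.dirA k p‖ * ‖Pr.dirB k p‖ * Real.exp (-(κ * C₀.d (Pr.dom k p))) := key
      _ ≤ 4 * (2 * N) / α ^ 2 * K := mul_le_mul_of_nonneg_left (hK k) (by positivity)
      _ = 8 * K / α ^ 2 * N := by ring

/-- The END's letter `hcr : 0 ≤ cr` for `cr := 8K∕α²`. [folklore] -/
theorem readConst_nonneg {α κ K : ℝ} (hK : ∀ k, ∑ p ∈ Pr.idx k, |Pr.wt k p| * ‖Pr.dirA k p‖ * ‖Pr.dirB k p‖ * Real.exp (-(κ * C₀.d (Pr.dom k p))) ≤ K) : 0 ≤ 8 * K / α ^ 2 := by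
  have hK0 : 0 ≤ K := localitySum_nonneg Pr hK
  positivity

/-! ## §4 The single-cube chart probes of record -/

section OfRecord

open Summit.QuantumFields.BalabanUV.T4Continuum.B13Carriers (TwoRuns)
open Summit.QuantumFields.BalabanUV.T4Continuum.SubstrateProbesOfRecord (cubeIdx cubeIdx_nonempty scale_of_mem_cubeIdx d_eq_zero_of_mem_cubeIdx)

variable {G : Type} [GaugeGroup G] (R : TwoRuns G)

/-- DATA: **THE SINGLE-CUBE CHART PROBES OF RECORD** on the carriers of record — at step `k` one probe per single-cube domain of scale
`k + 1` (the substrate's S-PROBE catalogue `cubeIdx R k`), reading that cube, with the instancer's chart directions and weights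
(for (1.20)–(1.22): the responses `h_□(x), h_□(y)` and the second-moment weights). [cite: Balaban1987RG1, (1.20)-(1.22) p.264] -/
def cubeChartProbes (dirA dirB : ℕ → R.carriers.Dom → E) (wt : ℕ → R.carriers.Dom → ℝ) : ChartProbes R.carriers E R.carriers.Dom where
  idx := cubeIdx R
  dom := fun _ X => X
  scale_dom := fun _ _ hp => scale_of_mem_cubeIdx hp
  dirA := dirA
  dirB := dirB
  wt := wt

variable {R} (dirA dirB : ℕ → R.carriers.Dom → E) (wt : ℕ → R.carriers.Dom → ℝ)

/-- Every step reads at least one probe of record. [folklore] -/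
theorem cubeChartProbes_idx_nonempty (k : ℕ) : ((cubeChartProbes R dirA dirB wt).idx k).Nonempty := cubeIdx_nonempty R k

/-- **THE LOCALITY LETTER OF THE PROBES OF RECORD IS THE PLAIN SUM** (single cubes have `d = 0`): `Σ_{□ ∈ cubeIdx k} |wt|‖a‖‖b‖ ≤ K`
gives the displayed locality hypothesis of §3 at every rate `κ`. [cite: Balaban1987RG1, (1.18) p.263] -/
theorem localitySum_cubeChartProbes {K : ℝ} (κ : ℝ)
    (hK : ∀ k, ∑ X ∈ cubeIdx R k, |wt k X| * ‖dirA k X‖ * ‖dirB k X‖ ≤ K) (k : ℕ) :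
    ∑ p ∈ (cubeChartProbes R dirA dirB wt).idx k, |(cubeChartProbes R dirA dirB wt).wt k p| * ‖(cubeChartProbes R dirA dirB wt).dirA k p‖ *
        ‖(cubeChartProbes R dirA dirB wt).dirB k p‖ * Real.exp (-(κ * R.carriers.d ((cubeChartProbes R dirA dirB wt).dom k p))) ≤ K := by
  refine le_trans (le_of_eq (Finset.sum_congr rfl fun X hX => ?_)) (hK k)
  show |wt k X| * ‖dirA k X‖ * ‖dirB k X‖ * Real.exp (-(κ * R.carriers.d X)) = |wt k X| * ‖dirA k X‖ * ‖dirB k X‖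
  rw [d_eq_zero_of_mem_cubeIdx hX, mul_zero, neg_zero, Real.exp_zero, mul_one]

/-- **`ReadBoundedOn` FOR THE PROBES OF RECORD** (node U2's (R) shape) from the plain locality sum. [cite: Balaban1987RG1, (1.20)-(1.22) p.264 and (4.3)-(4.5) pp.281-282] -/
theorem readBoundedOn_cubeChartProbes {α K : ℝ} (κ : ℝ) (hα : 0 < α)
    (hK : ∀ k, ∑ X ∈ cubeIdx R k, |wt k X| * ‖dirA k X‖ * ‖dirB k X‖ ≤ K) :
    ReadBoundedOn ((cubeChartProbes R dirA dirB wt).Analytic α) (cubeChartProbes R dirA dirB wt).recipe κ (8 * K / α ^ 2) :=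
  readBoundedOn_recipe _ hα (localitySum_cubeChartProbes dirA dirB wt κ hK) (cubeChartProbes_idx_nonempty dirA dirB wt)

/-- **`ReadSize` FOR THE PROBES OF RECORD** on any probe-analytic admissible class. [cite: Balaban1987RG1, (1.18) p.263 and (1.20)-(1.22) p.264] -/
theorem readSize_shiftRead_cubeChartProbes {α K : ℝ} (κ : ℝ) (hα : 0 < α)
    (hK : ∀ k, ∑ X ∈ cubeIdx R k, |wt k X| * ‖dirA k X‖ * ‖dirB k X‖ ≤ K) {Adm : Set (E → (doubleCarriers R.carriers).Dom → ℝ)}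
    (hAdm : Adm ⊆ (cubeChartProbes R dirA dirB wt).Analytic α) :
    ReadSize Adm (shiftRead (cubeChartProbes R dirA dirB wt).recipe) κ (8 * K / α ^ 2) :=
  readSize_shiftRead_recipe _ hα (localitySum_cubeChartProbes dirA dirB wt κ hK) hAdm

end OfRecord

/-! ## §5 The AW letter on single cubes: `DirSize` from a plain sup bound -/

section DirOfRecord

open Summit.QuantumFields.BalabanUV.T4Continuum.B13Carriers (TwoRuns)
open Summit.QuantumFields.BalabanUV.T4Continuum.SubstrateProbesOfRecord (cubeIdx d_eq_zero_of_mem_cubeIdx)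

variable {G : Type} [GaugeGroup G] {R : TwoRuns G}

omit [NormedAddCommGroup E] [NormedSpace ℂ E] in
/-- **AW ON SINGLE CUBES.**  A marginal direction supported on the single-cube domains (the Wilson action `A^η` of [I] (1.3) distributed over
the single cubes of each scale, zero elsewhere — WALL-NE9-P1 §3 (iii)) and bounded there by `a` uniformly in the chart point satisfies the END's
`DirSize A κ a` at EVERY rate `κ` (single cubes have `d = 0`).  The uniform bound itself (|A_□| ≤ a on the complex domain, [I] (1.11)–(1.14)
p. 262) stays the displayed T-letter AW. [cite: Balaban1987RG1, (1.3) p.260, (1.11)-(1.14) p.262 and (1.18) p.263] -/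
theorem dirSize_of_cubeSupported {A : E → (doubleCarriers R.carriers).Dom → ℝ} {a : ℝ} (κ : ℝ) (ha : 0 ≤ a)
    (hsupp : ∀ (Vc : E) (X : (doubleCarriers R.carriers).Dom), (∀ k, X.1 ∉ cubeIdx R k) → A Vc X = 0)
    (hbd : ∀ (Vc : E) (X : (doubleCarriers R.carriers).Dom) (k : ℕ), X.1 ∈ cubeIdx R k → |A Vc X| ≤ a) :
    DirSize A κ a := by
  intro Vc X
  by_cases h : ∃ k, X.1 ∈ cubeIdx R k
  · obtain ⟨k, hk⟩ := h
    have hd : (doubleCarriers R.carriers).d X = 0 := d_eq_zero_of_mem_cubeIdx hk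
    rw [hd, mul_zero, neg_zero, Real.exp_zero, mul_one]
    exact hbd Vc X k hk
  · rw [hsupp Vc X (fun k hk => h ⟨k, hk⟩), abs_zero]
    positivity

end DirOfRecord

end Summit.QuantumFields.BalabanUV.T4Continuum.NE9ChartReadOut

end
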